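import Summits.MatrixMultiplication.MatrixMultiplication.Theses.MarginalColumns
import Literature.Computability.AlgebraicComplexity.BorderRankMatMulRectangular

/-!
# Line `reduced-gluing` for crux `SecondColumnCheap` (C) — stmt-MatrixMultiplication-16309

**⚠ DEAD ON ARRIVAL (strategist self-refutation, 2026-08-17).**  `stub_reducedPairCheap` below is FALSE: by the
forced-slot first-order border-apolarity lemma of `NegativeNotesStrategist.md` §S2–S3 (crux workfile),
`bR(⟨2,k,1⟩ + s entries of a second column) ≥ 2k + ⌈(3s−k)/3⌉`, so its instances `w = 1` force the column
marginals of the flat tower below `2k/3 + O(1) + 3σ`, contradicting flattening for large `k`.  See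
`Lines/reduced_gluing.md (dead-line card)`.  Published FOR THE RECORD ONLY: (i) the exact refuted signature, (ii) the TRUE
gluing stub `stub_glueReduced` (provable now), (iii) the sorry-free assembly `SecondColumnCheap_of`, reusable by
any future gluing-type line with a true pair statement (it turns `T(m+2) ≤ T(m) + 2n + 2 + σ` into C).  NOT
skeleton-registered (the live skeleton stays `birth`); leads must not pick this file.

ORIGINAL CARD TEXT (kept):

Route `route-MatrixMultiplication-MarginalColumns` (rank-2 crux); strategist line (lens: TRANSFER), an
ALTERNATIVE to the registered line `birth` (it does not touch `birth`'s stubs).  The crux, with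
`bR := algBorderRank` over `ℂ[ε]`:

  `C : ∀ ε > 0, ∃ C, ∀ n ≥ 1, bR⟨n,n,2⟩ ≤ n² + C·n^{1+ε}`.

THE TRANSFER.  By cyclic symmetry `bR⟨n,n,2⟩ = bR⟨2,n,n⟩` (`algBorderRank_matMulTensor_rotate`), and
`⟨2,n,n⟩` is the `w = n` member of the COLUMN TOWER OF THE FLAT FORMAT `w ↦ ⟨2,k,w⟩` (a `2 × k` matrix
`X` times a `k × w` matrix `Y`) at `k = n`.  At `k = 2` this tower IS the route's solved sibling
`bR⟨2,2,w⟩ = bR⟨w,2,2⟩ ∈ [3w, 3w + ⌈w/7⌉]`, and the sibling's winning MECHANISM is known exactly: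
Landsberg–Ryder 2017 Prop. 3.1 (= `LandsbergRyder2017_prop_3_1`, "dates back to BCLR79"): glue two
REDUCED tensors along a shared, split row/column,
  `bR⟨m+m'−1,2,2⟩ ≤ bR(T_{BCLRS,m}) + bR(T_{BCLRS,m'})`,
with the reduced pieces cheap: `bR(T_{BCLR}) = 5`, `bR(T_{BCLRS,3}) = 8` (Alekseev–Smirnov), expected
`3m − 1` for all `m` (LandsbergGCT2017 §4.8.2).  This line transplants THAT mechanism verbatim to every
`k`: the reduced tensor `redMatMul k w S` is `⟨2,k,w+1⟩` whose LAST column of `Y` keeps only the entries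
in `S ⊂ [k]` (at `k = 2`, `|S| = 1` it is `T_{BCLRS,w+1}` transposed), and
* `stub_glueReduced` — the gluing inequality for all `k`: two reduced pieces with complementary
  partial columns `S`, `Sᶜ` glue to the full tower member with `w + w' + 1` columns (subadditivity of
  `bR` + zero-padding; Landsberg–Ryder's five-line proof; PROVABLE NOW, M-sized);
* `stub_reducedPairCheap` — the content: for every `θ > 0` there is `L` such that for all `k ≥ 1`,
  `w, w' ≥ 1` SOME split `S` makes the complementary pair cost at most the two shorter towers plus
  `2 + L·k^θ`:  `bR(red k w S) + bR(red k w' Sᶜ) ≤ bR⟨2,k,w⟩ + bR⟨2,k,w'⟩ + 2 + L k^θ`.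
  LAW-EXACT with slack 0 under the hollow-schoolbook law `bR⟨2,k,w⟩ = (k+1)w + (k−1)`
  (`law(w+w'+1) = law(w) + law(w') + 2`); at `k = 2` it is Landsberg's printed expectation
  `bR(T_{BCLRS,m}) ≤ 3m − 1` in two-piece form, TRUE for `w, w' ≤ 2` (5+5 ≤ 4+4+2, 5+8 ≤ 4+7+2,
  8+8 ≤ 7+7+2).  Its first cells beyond the sibling are tiny decidable formats (card §Cheapest falsifier):
  `bR(⟨2,3,1⟩ ⊕' one entry) ∈ {6,7}` (format 6×4×4), `bR(⟨2,3,1⟩ ⊕' two entries) ∈ {8,9}` (6×5×4),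
  `bR(⟨2,4,1⟩ ⊕' two entries) ∈ {9,10}` (8×6×4) — Koszul flattenings (this session, exp/koszul.py) give
  exactly the law-additive values 6 / 8 / 9 as LOWER bounds, so nothing in tree separates the stub from
  the truth at its first cells.
ASSEMBLY (`SecondColumnCheap_of`, sorry-free): with `T(m) := bR⟨2,n,m⟩`, the stubs at `(w,w') = (1,m)`
give `T(m+2) ≤ T(1) + T(m) + 2 + L n^θ ≤ T(m) + 2n + 2 + L n^θ` (`T(1) ≤ 2n`, standard algorithm);
induction from `T(1) ≤ 2n`, `T(2) ≤ 4n` gives `T(n) ≤ n² + 3n + (n/2)·L n^θ`, i.e. C with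
`C := 3 + max L 0` at `θ := ε`.  NO use of the sibling tower `bR⟨n,2,2⟩` (odd widths are glued from
`T(1)` alone; even widths start from the trivial `T(2) ≤ 4n`, losing only `O(n)`), and no
row-dominance inequality: the line shares no stub with `birth`.

DISPROOF USED: no `Disproof.lean` is registered for this crux (`ledger crux ls`, 2026-08-17T12:30Z).
Checked against the landed `Theorems/SecondColumnCheap/Negative/LoadBearing.lean` (p146193): the line is
an all-`n` statement (consistent with `secondColumnCheap_iff_eventually`), uses `0 < ε` only as slack
(`secondColumnCheap_iff_unit_interval`), yields `C ≥ 3 ≥ 1` (`one_le_const`), involves no Kronecker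
powering (`borderRank_mul_le` moral respected: the recursion is ADDITIVE in `w`, not multiplicative in
`n`), and dies exactly by `secondColumnCheap_false_of_secondColumnGrowth` if `SecondColumnGrowth` lands.
Negatives index (`ledger negatives --problem MatrixMultiplication`): all STPP/design-side, untouched.
BARRIERS: as the route (technique_class border-rank-small-formats / format-induction).  InfimumNotMinimum
respected (all-`k`, all-`w` statements with slack; no single cell certifies an exponent); Irreversibility /
UniversalMethod / UnstableTensor / Rectangular not in class (no carrier tensor, no laser method, no
powering); LinearRankMethod bears only on REFUTING `stub_reducedPairCheap` (its decisive cells are of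
size ≤ 10, far below cactus caps) — no obstruction either way.
-/

set_option linter.dupNamespace false

namespace Summit.MatrixMultiplication.MatrixMultiplication.Cruxes.SecondColumnCheap.ReducedGluing

open Literature.Computability.AlgebraicComplexity

/-! ## The reduced tensors of the flat column tower `w ↦ ⟨2,k,w⟩` -/

/-- **The reduced tensor `⟨2,k,w+1⟩^red_S`** (Landsberg–Ryder's `T_{BCLRS}` transplanted to inner
dimension `k`): the tensor of `(X, Y) ↦ XY` for `X ∈ ℂ^{2×k}`, `Y ∈ ℂ^{k×(w+1)}` in which the entries
`y_{j,w}` of the LAST column of `Y` with `j ∉ S` are set to zero (tree format of `matMulTensor ℂ 2 k (w+1)`: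
first slot the output `Z = Fin 2 × Fin (w+1)`, second `X = Fin 2 × Fin k`, third `Y = Fin k × Fin (w+1)`).
At `k = 2`, `S = {j}` it is `T_{BCLRS,w+1}` of `LandsbergRyder2017_prop_3_1` up to transposition. -/
noncomputable def redMatMul (k w : ℕ) (S : Finset (Fin k)) :
    Fin 2 × Fin (w + 1) → Fin 2 × Fin k → Fin k × Fin (w + 1) → ℂ :=
  fun c a b => if b.2 = Fin.last w ∧ b.1 ∉ S then 0 else matMulTensor ℂ 2 k (w + 1) c a b

/-! ## Stub signatures (named, so that the composition takes them BY NAME) -/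

/-- Signature of STUB 1 (`stub_glueReduced`): Landsberg–Ryder gluing for every inner dimension `k` —
two reduced pieces with complementary partial last columns `S`, `Sᶜ` glue (sharing `X` and the split
column) to the tower member with `w + w' + 1` columns. -/
abbrev Sig.stub_glueReduced : Prop :=
  ∀ (k w w' m : ℕ) (S : Finset (Fin k)), m = w + w' + 1 →
    algBorderRank (matMulTensor ℂ 2 k m) ≤
      algBorderRank (redMatMul k w S) + algBorderRank (redMatMul k w' Sᶜ)

/-- Signature of STUB 2 (`stub_reducedPairCheap`): for every `θ > 0` there is `L` such that for all
`k ≥ 1` and `w, w' ≥ 1` some split `S ⊂ [k]` makes the complementary reduced pair cost at most the two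
shorter towers plus `2 + L·k^θ`. -/
abbrev Sig.stub_reducedPairCheap : Prop :=
  ∀ θ : ℝ, 0 < θ → ∃ L : ℝ, ∀ k : ℕ, 1 ≤ k → ∀ w w' : ℕ, 1 ≤ w → 1 ≤ w' →
    ∃ S : Finset (Fin k),
      (algBorderRank (redMatMul k w S) : ℝ) + (algBorderRank (redMatMul k w' Sᶜ) : ℝ) ≤
        (algBorderRank (matMulTensor ℂ 2 k w) : ℝ) + (algBorderRank (matMulTensor ℂ 2 k w') : ℝ) +
          2 + L * (k : ℝ) ^ θ

/-! ## The stubs (the only `sorry`s of the file) -/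

/-- **Stub 1 (gluing reduced tensors, all `k`).**  For all `k, w, w'` and every `S ⊂ [k]`,
`bR⟨2,k,w+w'+1⟩ ≤ bR(⟨2,k,w+1⟩^red_S) + bR(⟨2,k,w'+1⟩^red_{Sᶜ})`.  Proof route (PROVABLE NOW, M-sized):
embed the columns of piece 1 as `0,…,w` and of piece 2 as `w` (its reduced column) and `w+1,…,w+w'`;
the zero-padded pieces SUM to `matMulTensor ℂ 2 k (w+w'+1)` entrywise (the shared column `w` receives
the `S`-part from piece 1 and the `Sᶜ`-part from piece 2); zero-padding is a restriction
(`TensorRestrictsTo.algBorderRank_le` / `algBorderRank_precomp_le`), and `bR(s + t) ≤ bR(s) + bR(t)`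
(concatenate approximate decompositions after equalising their orders by powers of `ε`).  At `k = 2`,
`|S| = 1` this is exactly Landsberg–Ryder 2017 Prop. 3.1 (`LandsbergRyder2017_prop_3_1`, named fact). -/
theorem stub_glueReduced :
    ∀ (k w w' m : ℕ) (S : Finset (Fin k)), m = w + w' + 1 →
      algBorderRank (matMulTensor ℂ 2 k m) ≤
        algBorderRank (redMatMul k w S) + algBorderRank (redMatMul k w' Sᶜ) := by
  sorry

/-- **Stub 2 (a complementary reduced pair costs the two shorter towers plus `2 + o(k)`).**
For every `θ > 0` there is `L` with: for all `k ≥ 1`, `w, w' ≥ 1` there is `S ⊂ [k]` such that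
`bR(⟨2,k,w+1⟩^red_S) + bR(⟨2,k,w'+1⟩^red_{Sᶜ}) ≤ bR⟨2,k,w⟩ + bR⟨2,k,w'⟩ + 2 + L·k^θ`.
Why plausibly true: it is LAW-EXACT (slack 0) under the hollow-schoolbook law
`bR⟨2,k,w⟩ = (k+1)w + (k−1)` (`law(w+w'+1) − law(w) − law(w') = 2`): writing
`bR(red k w S) = bR⟨2,k,w⟩ + c(S)`, the stub asks for `c(S) + c(Sᶜ) ≤ 2 + o(k)` while the full column
costs `k + 1`; lower bounds force `c(S) ≥ 2|S| − k + 1`, so the balanced split `|S| = ⌊k/2⌋` with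
`c = 1 + 1` (even `k`) or `(|S|,|Sᶜ|) = ((k−1)/2,(k+1)/2)` with `c = 0 + 2` (odd `k`) is the predicted
witness.  At `k = 2` this is Landsberg's expectation `bR(T_{BCLRS,m}) ≤ 3m − 1` (LandsbergGCT2017
§4.8.2; LandsbergRyder2015 §3) in two-piece form and is TRUE for `w, w' ≤ 2` by BCLR (`5`) and
Alekseev–Smirnov (`8`): `5+5 ≤ 4+4+2`, `5+8 ≤ 4+7+2`, `8+8 ≤ 7+7+2`.  First cells beyond the sibling
(slack-0 form): `k = 3, w = w' = 1`: `bR(⟨2,3,1⟩ + y_{0,1}) + bR(⟨2,3,1⟩ + y_{1,1} + y_{2,1}) ≤ 6 + 6 + 2`,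
i.e. the cells `6` and `8` (Koszul lower bounds: exactly `6` and `8`); then gluing re-derives Smirnov's
`bR⟨2,3,3⟩ = 14` and predicts `bR⟨2,3,5⟩ ≤ 22`, `bR⟨2,4,3⟩ ≤ 18` (new).  REFUTED (2026-08-17, NegativeNotesStrategist §S3 C2): the instances `w = 1` are false for
all large `k`.  Original risk note: the reduced
pieces may be LOSSY from `k = 3` on (`c(1) = 1` at `⟨2,3,1⟩ + one entry` would make Smirnov's 14 a
non-gluing and leave only the `o(k)` slack to absorb a loss per gluing); and bulk growth
`bR⟨2,n,n⟩ ≥ (1+c)n²` (route support `SecondColumnGrowth`) kills it together with C. -/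
theorem stub_reducedPairCheap :
    ∀ θ : ℝ, 0 < θ → ∃ L : ℝ, ∀ k : ℕ, 1 ≤ k → ∀ w w' : ℕ, 1 ≤ w → 1 ≤ w' →
      ∃ S : Finset (Fin k),
        (algBorderRank (redMatMul k w S) : ℝ) + (algBorderRank (redMatMul k w' Sᶜ) : ℝ) ≤
          (algBorderRank (matMulTensor ℂ 2 k w) : ℝ) + (algBorderRank (matMulTensor ℂ 2 k w') : ℝ) +
            2 + L * (k : ℝ) ^ θ := by
  sorry

/-! ## Assembly (sorry-free) -/

/-- **Assembly**: the two stub signatures (BY NAME) imply the crux `MarginalColumns.SecondColumnCheap`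
BY NAME.  With `T(m) := bR⟨2,n,m⟩`: `stub_glueReduced` at `(w,w') = (1,m)` and `stub_reducedPairCheap`
give `T(m+2) ≤ T(1) + T(m) + 2 + L n^ε`; `T(1) ≤ 2n`, `T(2) ≤ 4n` (standard algorithm); induction on
`m` in steps of two; `bR⟨n,n,2⟩ = bR⟨2,n,n⟩` (two rotations); `rpow` bookkeeping with `C := 3 + max L 0`. -/
theorem SecondColumnCheap_of :
    Sig.stub_glueReduced → Sig.stub_reducedPairCheap →
      Summit.MatrixMultiplication.MatrixMultiplication.Theses.MarginalColumns.SecondColumnCheap := by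
  intro hglue hpair ε hε
  obtain ⟨L, hL⟩ := hpair ε hε
  set M : ℝ := max L 0 with hM
  have hM0 : 0 ≤ M := le_max_right _ _
  have hLM : L ≤ M := le_max_left _ _
  refine ⟨3 + M, ?_⟩
  intro n hn
  have hn0 : (0 : ℝ) < n := by exact_mod_cast (show 0 < n by omega)
  have hn1 : (1 : ℝ) ≤ n := by exact_mod_cast hn
  have hnε0 : 0 ≤ (n : ℝ) ^ ε := Real.rpow_nonneg hn0.le ε
  -- The slack of one gluing, majorised.
  set s : ℝ := M * (n : ℝ) ^ ε with hs
  have hs0 : 0 ≤ s := mul_nonneg hM0 hnε0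
  have hLs : L * (n : ℝ) ^ ε ≤ s := mul_le_mul_of_nonneg_right hLM hnε0
  -- Base values of the flat tower `T(m) = bR⟨2,n,m⟩`: `T(1) ≤ 2n`, `T(2) ≤ 4n` (standard algorithm).
  have hT1 : (algBorderRank (matMulTensor ℂ 2 n 1) : ℝ) ≤ 2 * (n : ℝ) := by
    have h := (algBorderRank_le_tensorRank _).trans (tensorRank_matMulTensor_le ℂ 2 n 1)
    have h' : (algBorderRank (matMulTensor ℂ 2 n 1) : ℝ) ≤ ((2 * n * 1 : ℕ) : ℝ) := by
      exact_mod_cast h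
    push_cast at h'
    linarith
  have hT2 : (algBorderRank (matMulTensor ℂ 2 n 2) : ℝ) ≤ 4 * (n : ℝ) := by
    have h := (algBorderRank_le_tensorRank _).trans (tensorRank_matMulTensor_le ℂ 2 n 2)
    have h' : (algBorderRank (matMulTensor ℂ 2 n 2) : ℝ) ≤ ((2 * n * 2 : ℕ) : ℝ) := by
      exact_mod_cast h
    push_cast at h'
    linarith
  -- One step of the recursion: T(m+2) ≤ T(m) + 2n + 2 + s (glue a reduced `⟨2,n,2⟩^red_S` onto a
  -- reduced `⟨2,n,m+1⟩^red_{Sᶜ}`).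
  have hstep : ∀ m : ℕ, 1 ≤ m →
      (algBorderRank (matMulTensor ℂ 2 n (m + 2)) : ℝ) ≤
        (algBorderRank (matMulTensor ℂ 2 n m) : ℝ) + 2 * (n : ℝ) + 2 + s := by
    intro m hm
    obtain ⟨S, hS⟩ := hL n hn 1 m le_rfl hm
    have hg := hglue n 1 m (m + 2) S (by omega)
    have hg' : (algBorderRank (matMulTensor ℂ 2 n (m + 2)) : ℝ) ≤
        (algBorderRank (redMatMul n 1 S) : ℝ) + (algBorderRank (redMatMul n m Sᶜ) : ℝ) := by
      exact_mod_cast hg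
    linarith [hS, hT1, hg', hLs]
  -- Induction in steps of two from the two base values.
  have hodd : ∀ j : ℕ, (algBorderRank (matMulTensor ℂ 2 n (2 * j + 1)) : ℝ) ≤
      2 * (n : ℝ) + (j : ℝ) * (2 * (n : ℝ) + 2 + s) := by
    intro j
    induction j with
    | zero => simpa using hT1
    | succ j ih =>
      have h := hstep (2 * j + 1) (by omega)
      have e : 2 * (j + 1) + 1 = 2 * j + 1 + 2 := by ring
      rw [e]
      push_cast
      linarith [h, ih]
  have heven : ∀ j : ℕ, (algBorderRank (matMulTensor ℂ 2 n (2 * j + 2)) : ℝ) ≤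
      4 * (n : ℝ) + (j : ℝ) * (2 * (n : ℝ) + 2 + s) := by
    intro j
    induction j with
    | zero => simpa using hT2
    | succ j ih =>
      have h := hstep (2 * j + 2) (by omega)
      have e : 2 * (j + 1) + 2 = 2 * j + 2 + 2 := by ring
      rw [e]
      push_cast
      linarith [h, ih]
  -- The width n itself: T(n) ≤ n² + 3n + (n/2)·s.
  have key : (algBorderRank (matMulTensor ℂ 2 n n) : ℝ) ≤
      (n : ℝ) ^ 2 + 3 * (n : ℝ) + (n : ℝ) / 2 * s := by
    rcases Nat.even_or_odd n with ⟨j, hj⟩ | ⟨j, hj⟩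
    · obtain ⟨i, rfl⟩ : ∃ i, j = i + 1 := ⟨j - 1, by omega⟩
      have e : n = 2 * i + 2 := by omega
      have h := heven i
      rw [← e] at h
      have hi : (i : ℝ) = ((n : ℝ) - 2) / 2 := by
        have : (n : ℝ) = 2 * (i : ℝ) + 2 := by exact_mod_cast e
        linarith
      rw [hi] at h
      nlinarith [h, hs0, hn1]
    · have e : n = 2 * j + 1 := by omega
      have h := hodd j
      rw [← e] at h
      have hj' : (j : ℝ) = ((n : ℝ) - 1) / 2 := by
        have : (n : ℝ) = 2 * (j : ℝ) + 1 := by exact_mod_cast e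
        linarith
      rw [hj'] at h
      nlinarith [h, hs0, hn1]
  -- Cyclic symmetry: bR⟨n,n,2⟩ = bR⟨2,n,n⟩.
  have hrot : algBorderRank (matMulTensor ℂ n n 2) = algBorderRank (matMulTensor ℂ 2 n n) := by
    rw [algBorderRank_matMulTensor_rotate ℂ n n 2, algBorderRank_matMulTensor_rotate ℂ n 2 n]
  -- rpow bookkeeping: n ≤ n^{1+ε} = n·n^ε.
  have hpow1 : (n : ℝ) ≤ (n : ℝ) ^ (1 + ε) := by
    have h := Real.rpow_le_rpow_of_exponent_le hn1 (show (1 : ℝ) ≤ 1 + ε by linarith)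
    rwa [Real.rpow_one] at h
  have hsplit : (n : ℝ) ^ (1 + ε) = (n : ℝ) * (n : ℝ) ^ ε := by
    rw [Real.rpow_add hn0, Real.rpow_one]
  show (algBorderRank (matMulTensor ℂ n n 2) : ℝ) ≤ (n : ℝ) ^ 2 + (3 + M) * (n : ℝ) ^ (1 + ε)
  rw [hrot]
  have hns : (n : ℝ) / 2 * s ≤ M * (n : ℝ) ^ (1 + ε) := by
    rw [hsplit, hs]
    nlinarith [hM0, hnε0, hn0.le]
  nlinarith [key, hpow1, hns, hM0, hnε0, hn0.le]

/-- **Skeleton conclusion** (h21 skeleton format `<Crux>_proof`): the crux BY NAME from the two stubs.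
The only `sorry`s of the file sit inside `stub_glueReduced` and `stub_reducedPairCheap`. -/
theorem SecondColumnCheap_proof :
    Summit.MatrixMultiplication.MatrixMultiplication.Theses.MarginalColumns.SecondColumnCheap :=
  SecondColumnCheap_of stub_glueReduced stub_reducedPairCheap

end Summit.MatrixMultiplication.MatrixMultiplication.Cruxes.SecondColumnCheap.ReducedGluing
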